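import Mathlib
import Summits.PneNP.PneNP.Theorems.ConvexRankGatesConvexGateBlindAffineRank
import Summits.PneNP.PneNP.Theorems.ConvexRankGatesConvexGateBlindRankForm

/-!
# PneNP / ConvexRankGates — `ConvexGateBlind`: dual-affine PSD + LP refutations reduce to the exclusion number of the pencil

Helpers (`--supports stmt-PneNP-10680`), COLUMN-SPACE line (prover seat 2, session 24). The canonical form of the crux
forbids `cdist Q u − ε = tr(H_u Y_Q) + ∑_l U_l(u) V_l(Q)` with `H_u, Y_Q ⪰ 0` and `U, V ≥ 0`. In the DUAL-AFFINE class the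
`u`-indexed objects are affine in the graph: `H_u = H₀ − ∑_{e ∈ u} H_e` (an affine `q × q` pencil) and `U_l(u) = a_l − t_l(u)`.
Evaluating the (affine) identity at the bare clique `1_{E(Q)}` — through the clique-free graphs `∅` and `{f}` — gives

    tr(H(1_{E(Q)}) Y_Q) + ∑_l (a_l − t_l(E(Q))) V_l(Q) = −ε,

so every `k`-set at which the pencil is positive semidefinite (`tr(H(1_{E(Q)})Y_Q) ≥ 0`) is CAUGHT by an LP term
(`V_l(Q) > 0`, `t_l(E(Q)) > a_l ≥ t_l(u)` on clique-free `u`), and by the uniqueness of the caught clique distinct such `Q` use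
distinct `l`. Hence (`dualAffine_psd_count`)

    C(m,k) ≤ R + #{Q : H(1_{E(Q)}) ⋡ 0},

for ANY affine pencil (its validity on clique-free graphs is what bounds the second term — the EXCLUSION NUMBER of the pencil,
`…AffinePencil.lean`, `…AffinePencilThree.lean`, memo ANALYSIS-seat2-s24 §2, sub-question `Q_psd`). [new]
-/

set_option linter.dupNamespace false

namespace Summit.PneNP.PneNP.Theorems

open Finset Real Filter Matrix Literature.Computability.Complexity
open Summit.PneNP.PneNP.Cruxes.ConvexGateBlind.StrictRankConicCover (Edge cdist)

noncomputable section

variable {m : ℕ}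

/-- The trace pairing with an affine pencil is affine in the graph. [folklore] -/
theorem trace_pencil_mul {q : ℕ} (H₀ : Matrix (Fin q) (Fin q) ℝ) (He : Edge m → Matrix (Fin q) (Fin q) ℝ)
    (c : Edge m → Bool) (Z : Matrix (Fin q) (Fin q) ℝ) :
    ((H₀ - ∑ e, if c e = true then He e else 0) * Z).trace =
      (H₀ * Z).trace - ∑ e, (if c e = true then (He e * Z).trace else 0) := by
  rw [Matrix.sub_mul, Matrix.trace_sub, Finset.sum_mul, Matrix.trace_sum]
  congr 1
  refine Finset.sum_congr rfl fun e _ => ?_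
  split_ifs <;> simp

open Classical in
/-- **Dual-affine PSD + LP refutations are counted by the exclusion number of the pencil.** Let `3 ≤ k`, `ε > 0`,
`Y_Q ⪰ 0` and `V_l ≥ 0` on `k`-sets, column objects affine in the graph (`U_l(u) = a_l − t_l(u) ≥ 0` on `k`-clique-free `u`)
and `H_u = H₀ − ∑_{e∈u} H_e` ANY affine `q × q` pencil, with
`cdist Q u − ε = tr(H_u Y_Q) + ∑_{l<R} U_l(u) V_l(Q)` for all `k`-sets `Q` and `k`-clique-free `u`. Then
`C(m,k) ≤ R + #{Q : H(1_{E(Q)}) ⋡ 0}`. [new] -/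
theorem dualAffine_psd_count {k q R : ℕ} (hk : 3 ≤ k)
    (H₀ : Matrix (Fin q) (Fin q) ℝ) (He : Edge m → Matrix (Fin q) (Fin q) ℝ)
    (Y : Finset (Fin m) → Matrix (Fin q) (Fin q) ℝ) (hY : ∀ Q : Finset (Fin m), Q.card = k → (Y Q).PosSemidef)
    (U : (Edge m → Bool) → Fin R → ℝ) (V : Fin R → Finset (Fin m) → ℝ)
    (hU : ∀ u l, cliqueFn m k u = false → 0 ≤ U u l)
    (hV : ∀ l (Q : Finset (Fin m)), Q.card = k → 0 ≤ V l Q)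
    (haff : ∀ l, ∃ (a : ℝ) (t : Edge m → ℝ), ∀ u, cliqueFn m k u = false →
      U u l = a - ∑ f, (if u f = true then t f else 0))
    (ε : ℝ) (hε : 0 < ε)
    (hfact : ∀ (Q : Finset (Fin m)) (u : Edge m → Bool), Q.card = k → cliqueFn m k u = false →
      cdist Q u - ε = ((H₀ - ∑ e, if u e = true then He e else 0) * Y Q).trace + ∑ l, U u l * V l Q) :
    m.choose k ≤ R + (((Finset.univ : Finset (Fin m)).powersetCard k).filter fun Q =>
      ¬ (H₀ - ∑ e, if cliqueVec Q e = true then He e else 0).PosSemidef).card := by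
  classical
  choose a t hat using haff
  have hvalid : ∀ l (u : Edge m → Bool), cliqueFn m k u = false → (∑ f, if u f = true then t l f else 0) ≤ a l := by
    intro l u hu
    have h := hU u l hu
    rw [hat l u hu] at h
    linarith
  have hU0 : ∀ l, U (fun _ => false) l = a l := by
    intro l
    rw [hat l _ (cliqueFn_empty_eq_false hk)]
    simp
  -- the identity at the bare clique, for every `k`-set
  have hclique : ∀ Q : Finset (Fin m), Q.card = k →
      ((H₀ - ∑ e, if cliqueVec Q e = true then He e else 0) * Y Q).trace +
        ∑ l, (a l - ∑ f ∈ cliqueEdges Q, t l f) * V l Q = -ε := by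
    intro Q hQ
    have h0 := hfact Q (fun _ => false) hQ (cliqueFn_empty_eq_false hk)
    rw [trace_pencil_mul] at h0
    simp only [Bool.false_eq_true, if_false, Finset.sum_const_zero, sub_zero] at h0
    rw [cdist_empty, Finset.sum_congr rfl fun l _ => by rw [hU0 l]] at h0
    -- single edges
    have h1 : ∀ f : Edge m, (if cliqueVec Q f = true then (1 : ℝ) else 0) = (He f * Y Q).trace + ∑ l, t l f * V l Q := by
      intro f
      have hf := hfact Q (fun g => decide (g = f)) hQ (cliqueFn_single_eq_false hk f)
      rw [trace_pencil_mul] at hf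
      have hUf : ∀ l, U (fun g => decide (g = f)) l = a l - t l f := by
        intro l
        rw [hat l _ (cliqueFn_single_eq_false hk f)]
        congr 1
        rw [Finset.sum_eq_single f]
        · simp
        · intro g _ hgf; simp [hgf]
        · intro h; exact absurd (Finset.mem_univ f) h
      have hTf : (∑ e, if decide (e = f) = true then (He e * Y Q).trace else 0) = (He f * Y Q).trace := by
        rw [Finset.sum_eq_single f]
        · simp
        · intro g _ hgf; simp [hgf]
        · intro h; exact absurd (Finset.mem_univ f) h
      rw [hTf, Finset.sum_congr rfl fun l _ => by rw [hUf l]] at hf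
      rw [← cdist_empty_sub_cdist_single Q f]
      have hsub : ∑ l, (a l - t l f) * V l Q = ∑ l, a l * V l Q - ∑ l, t l f * V l Q := by
        rw [← Finset.sum_sub_distrib]; exact Finset.sum_congr rfl fun l _ => by ring
      rw [hsub] at hf
      rw [cdist_empty]
      linarith
    have hsumE : ((cliqueEdges Q).card : ℝ) =
        ∑ f ∈ cliqueEdges Q, (He f * Y Q).trace + ∑ l, (∑ f ∈ cliqueEdges Q, t l f) * V l Q := by
      have : ((cliqueEdges Q).card : ℝ) = ∑ f ∈ cliqueEdges Q, (if cliqueVec Q f = true then (1 : ℝ) else 0) := by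
        rw [Finset.card_eq_sum_ones (cliqueEdges Q)]
        push_cast
        refine Finset.sum_congr rfl fun f hf => ?_
        rw [cliqueEdges, Finset.mem_filter] at hf
        simp [hf.2]
      rw [this, Finset.sum_congr rfl fun f _ => h1 f, Finset.sum_add_distrib, Finset.sum_comm]
      congr 1
      exact Finset.sum_congr rfl fun l _ => by rw [Finset.sum_mul]
    have htrQ : (∑ e, if cliqueVec Q e = true then (He e * Y Q).trace else 0) = ∑ f ∈ cliqueEdges Q, (He f * Y Q).trace := by
      rw [cliqueEdges, Finset.sum_filter]
    rw [trace_pencil_mul, htrQ]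
    have hsplit : ∑ l, (a l - ∑ f ∈ cliqueEdges Q, t l f) * V l Q =
        ∑ l, a l * V l Q - ∑ l, (∑ f ∈ cliqueEdges Q, t l f) * V l Q := by
      rw [← Finset.sum_sub_distrib]; exact Finset.sum_congr rfl fun l _ => by ring
    rw [hsplit]
    linarith
  -- `k`-sets at which the pencil is PSD are caught by an LP term
  set S := (Finset.univ : Finset (Fin m)).powersetCard k with hS
  set P := S.filter fun Q => (H₀ - ∑ e, if cliqueVec Q e = true then He e else 0).PosSemidef with hP
  have hmemP : ∀ Q : P, (Q : Finset (Fin m)).card = k ∧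
      (H₀ - ∑ e, if cliqueVec (Q : Finset (Fin m)) e = true then He e else 0).PosSemidef := by
    intro Q
    have h : (Q : Finset (Fin m)) ∈ S.filter fun Q => (H₀ - ∑ e, if cliqueVec Q e = true then He e else 0).PosSemidef :=
      Q.2
    rw [Finset.mem_filter, hS, Finset.mem_powersetCard] at h
    exact ⟨h.1.2, h.2⟩
  have hcatch : ∀ Q : P, ∃ l, 0 < V l Q.1 ∧ a l < ∑ f ∈ cliqueEdges Q.1, t l f := by
    intro Q
    obtain ⟨hQ, hpsd⟩ := hmemP Q
    have h := hclique Q.1 hQ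
    have htr : 0 ≤ ((H₀ - ∑ e, if cliqueVec (Q : Finset (Fin m)) e = true then He e else 0) * Y Q.1).trace :=
      trace_mul_nonneg_of_posSemidef hpsd (hY Q.1 hQ)
    have hneg : ∑ l, (a l - ∑ f ∈ cliqueEdges Q.1, t l f) * V l Q.1 < ∑ _l : Fin R, (0 : ℝ) := by
      rw [Finset.sum_const_zero]; linarith
    obtain ⟨l, -, hl⟩ := Finset.exists_lt_of_sum_lt hneg
    have hVpos : 0 < V l Q.1 := by
      rcases (hV l Q.1 hQ).lt_or_eq with h' | h'
      · exact h'
      · rw [← h', mul_zero] at hl; exact absurd hl (lt_irrefl 0)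
    refine ⟨l, hVpos, ?_⟩
    have := neg_of_mul_neg_left hl hVpos.le
    linarith
  choose φ hφ using hcatch
  have hinj : Function.Injective φ := by
    intro Q₁ Q₂ h
    apply Subtype.ext
    have h1 := hφ Q₁
    have h2 := hφ Q₂
    rw [← h] at h2
    exact caught_clique_unique hk (t (φ Q₁)) (a (φ Q₁)) (hvalid (φ Q₁)) (hmemP Q₁).1 (hmemP Q₂).1 h1.2 h2.2
  have hcardP : P.card ≤ R := by
    have h := Fintype.card_le_of_injective φ hinj
    rwa [Fintype.card_coe, Fintype.card_fin] at h
  have hsplit := Finset.card_filter_add_card_filter_not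
    (s := S) (fun Q => (H₀ - ∑ e, if cliqueVec Q e = true then He e else 0).PosSemidef)
  have hScard : S.card = m.choose k := by
    rw [hS, Finset.card_powersetCard, Finset.card_univ, Fintype.card_fin]
  rw [← hScard, ← hsplit]
  exact Nat.add_le_add_right hcardP _

open Classical in
/-- **Dual-affine PSD + LP refutations are counted by the exclusion number** (registered form of `dualAffine_psd_count`). [new] -/
theorem dualAffine_psd_lp_count : ∀ {m k q R : ℕ}, 3 ≤ k → ∀ (H₀ : Matrix (Fin q) (Fin q) ℝ) (He : Edge m → Matrix (Fin q) (Fin q) ℝ) (Y : Finset (Fin m) → Matrix (Fin q) (Fin q) ℝ), (∀ Q : Finset (Fin m), Q.card = k → (Y Q).PosSemidef) → ∀ (U : (Edge m → Bool) → Fin R → ℝ) (V : Fin R → Finset (Fin m) → ℝ), (∀ u l, cliqueFn m k u = false → 0 ≤ U u l) → (∀ l (Q : Finset (Fin m)), Q.card = k → 0 ≤ V l Q) → (∀ l, ∃ (a : ℝ) (t : Edge m → ℝ), ∀ u, cliqueFn m k u = false → U u l = a - ∑ f, (if u f = true then t f else 0)) → ∀ (ε : ℝ), 0 < ε → (∀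 (Q : Finset (Fin m)) (u : Edge m → Bool), Q.card = k → cliqueFn m k u = false → cdist Q u - ε = ((H₀ - ∑ e, if u e = true then He e else 0) * Y Q).trace + ∑ l, U u l * V l Q) → m.choose k ≤ R + (((Finset.univ : Finset (Fin m)).powersetCard k).filter fun Q => ¬ (H₀ - ∑ e, if cliqueVec Q e = true then He e else 0).PosSemidef).card :=
  fun hk H₀ He Y hY U V hU hV haff ε hε hfact => dualAffine_psd_count hk H₀ He Y hY U V hU hV haff ε hε hfact

end

end Summit.PneNP.PneNP.Theorems
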